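import Mathlib
import Summits.FinalStateConjecture.FinalStateConjecture.Statement

/-!
# Shadow covering (crux `LaminatedThreshold`, idea card `horizon-shadowed-bag`, first lemma s3a)

Support lemma for the round-2 idea card `Cruxes/LaminatedThreshold/Ideas/horizon-shadowed-bag.md`
of crux A (`Theses.LaminatedThreshold.LaminatedThreshold`, item `stmt-FinalStateConjecture-16893`),
typed against the summit's settling predicate (`Summit.FinalStateConjecture.certifiedLate`,
`certifiedSlab`, `HasExhaustiveCharts`, `RaysStayInClosure` of `Statement.lean`).

`shadowCovering`: fix a decomposition `d : FinalStateDecomposition 𝓢 O k`, radii `R` and a chart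
time `τ₁` for which the exhaustion clause `O \ certifiedLate d R τ₁ ⊆ J⁻(certifiedSlab d R τ₁)`
holds (clause (ii) of `HasExhaustiveCharts`).  Let `B ⊆ M` ("bag side") and `T : M → ℝ`
("cosmological time") satisfy
(a) no exit towards the slab: `u ∈ B`, `u ∈ J⁻{q}`, `q ∈ certifiedSlab` ⇒ `q ∈ B`;
(b) `T` is causal-monotone on `B`;
(c) the flat chart's late image misses `B`;
(d) `T ≤ S` on `B ∩ certifiedSlab`.
Then every point `w ∈ closure O ∩ interior B` with `T` continuous at `w` and `S < T w` lies in the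
closure of the hole charts' certified near-zone tubes `⋃ i, chart i '' {τ₁ < t*ᵢ, rᵢ ≤ Rᵢ(t*ᵢ)}`.
`shadowCovering_of_raysStayInClosure` is the card's form: `w = γ t` on a future-complete
normalised null ray from the data, `w ∈ closure O` supplied by `RaysStayInClosure`.

Proof: point-set topology — a neighbourhood `V ∩ interior B ∩ {S < T}` of `w` meets `O` in a point
`u`; `u` is not in the flat late image by (c), and not in `J⁻(certifiedSlab)` by (a), (b), (d)
(`T u ≤ T q ≤ S`), so by exhaustion it lies in a tube. [folklore]
-/

open Set Filter Topology
open Literature.Geometry.Lorentzian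
open scoped Manifold ContDiff

set_option linter.dupNamespace false

namespace Summit.FinalStateConjecture.FinalStateConjecture.Theorems.LaminatedThreshold.HorizonShadowedBag

variable {𝓢 : Spacetime.{0} 4} {O : Set 𝓢.carrier} {k : ℕ}

/-- Membership in a causal past is witnessed pointwise: `u ∈ J⁻(S) ↔ ∃ q ∈ S, u ∈ J⁻{q}`.
[cite: ONeill1983, Ch. 14  p. 402] -/
theorem mem_causalPast_iff_exists {S : Set 𝓢.carrier} {u : 𝓢.carrier} :
    u ∈ 𝓢.metric.causalPast 𝓢.timeOrientation S ↔
      ∃ q ∈ S, u ∈ 𝓢.metric.causalPast 𝓢.timeOrientation {q} := by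
  simp only [LorentzianMetric.causalPast]
  rw [LorentzianMetric.causalFuture_eq_biUnion]
  simp only [mem_iUnion, exists_prop]


/-- **Shadow covering** (idea `horizon-shadowed-bag`, first lemma s3a, abstract form): under the
exhaustion clause at chart time `τ₁`, a point of `closure O` in the interior of a bag-side region
`B` (no exit towards the certified slab, a causal-monotone time `T` bounded by `S` on
`B ∩ certifiedSlab`, and the flat late image missing `B`) at which `T > S` lies in the closure of
the certified near-zone tubes of the hole charts. [folklore] -/
theorem shadowCovering (d : FinalStateDecomposition 𝓢 O k) (R : Fin d.N → ℝ → ℝ) (τ₁ : ℝ)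
    (hexh : O \ certifiedLate d R τ₁ ⊆
      𝓢.metric.causalPast 𝓢.timeOrientation (certifiedSlab d R τ₁))
    {B : Set 𝓢.carrier} {T : 𝓢.carrier → ℝ} {S : ℝ}
    (ha : ∀ q ∈ certifiedSlab d R τ₁, ∀ u ∈ B,
      u ∈ 𝓢.metric.causalPast 𝓢.timeOrientation {q} → q ∈ B)
    (hb : ∀ u ∈ B, ∀ q ∈ B, u ∈ 𝓢.metric.causalPast 𝓢.timeOrientation {q} → T u ≤ T q)
    (hc : Disjoint (d.flatChart '' (Minkowski.backgroundOn d.flatDomain).lateRegion τ₁) B)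
    (hd : ∀ q ∈ B ∩ certifiedSlab d R τ₁, T q ≤ S)
    {w : 𝓢.carrier} (hw : w ∈ closure O) (hwB : w ∈ interior B) (hTw : ContinuousAt T w)
    (hSw : S < T w) :
    w ∈ closure (⋃ i, d.chart i '' {x | τ₁ < (d.background i).time x.1 ∧
      (d.background i).radius x.1 ≤ R i ((d.background i).time x.1)}) := by
  rw [mem_closure_iff_nhds] at hw ⊢
  intro V hV
  -- the neighbourhood `V ∩ interior B ∩ {S < T}` of `w` meets `O`
  have hU : V ∩ interior B ∩ T ⁻¹' Ioi S ∈ 𝓝 w :=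
    inter_mem (inter_mem hV (isOpen_interior.mem_nhds hwB)) (hTw.preimage_mem_nhds (Ioi_mem_nhds hSw))
  obtain ⟨u, ⟨⟨huV, huB'⟩, huT⟩, huO⟩ := hw _ hU
  have huB : u ∈ B := interior_subset huB'
  refine ⟨u, huV, ?_⟩
  by_cases hlate : u ∈ certifiedLate d R τ₁
  · -- `u` is certified late: not by the flat chart (c), hence by a hole tube
    rcases hlate with hflat | htube
    · exact absurd huB (Set.disjoint_left.1 hc hflat)
    · exact htube
  · -- `u` is in the causal past of the certified slab: impossible by (a), (b), (d)
    exfalso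
    obtain ⟨q, hq, huq⟩ := mem_causalPast_iff_exists.1 (hexh ⟨huO, hlate⟩)
    have hqB : q ∈ B := ha q hq u huB huq
    have h1 : T u ≤ T q := hb u huB q hqB huq
    have h2 : T q ≤ S := hd q ⟨hqB, hq⟩
    exact absurd (mem_Ioi.1 huT) (not_lt.2 (h1.trans h2))

/-- **Shadow covering along a complete null ray** (idea `horizon-shadowed-bag`, first lemma s3a,
the card's form): for a Cauchy development `𝒟` whose future-complete normalised null rays stay in
`closure O` (`RaysStayInClosure 𝒟 O`) and a decomposition of `𝒟.toSpacetime` on `O` satisfying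
the exhaustion clause at `τ₁`, every event `γ t`, `t ≥ 0`, on such a ray that lies in the interior
of the bag-side region `B` with `T (γ t) > S` is in the closure of the certified near-zone tubes.
[folklore] -/
theorem shadowCovering_of_raysStayInClosure {X : Type} [TopologicalSpace X] [ChartedSpace E3 X]
    [IsManifold (𝓡 3) ∞ X] [ConnectedSpace X] {D : InitialDataSet (𝓡 3) X}
    (𝒟 : CauchyDevelopment D) {O : Set 𝒟.carrier} (hrays : RaysStayInClosure 𝒟 O)
    [𝒟.metric.HasLeviCivita] {k : ℕ}
    (d : FinalStateDecomposition 𝒟.toSpacetime O k) (R : Fin d.N → ℝ → ℝ) (τ₁ : ℝ)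
    (hexh : O \ certifiedLate d R τ₁ ⊆
      𝒟.metric.causalPast 𝒟.timeOrientation (certifiedSlab d R τ₁))
    {B : Set 𝒟.carrier} {T : 𝒟.carrier → ℝ} {S : ℝ}
    (ha : ∀ q ∈ certifiedSlab d R τ₁, ∀ u ∈ B,
      u ∈ 𝒟.metric.causalPast 𝒟.timeOrientation {q} → q ∈ B)
    (hb : ∀ u ∈ B, ∀ q ∈ B, u ∈ 𝒟.metric.causalPast 𝒟.timeOrientation {q} → T u ≤ T q)
    (hc : Disjoint (d.flatChart '' (Minkowski.backgroundOn d.flatDomain).lateRegion τ₁) B)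
    (hd : ∀ q ∈ B ∩ certifiedSlab d R τ₁, T q ≤ S)
    {p : X} {γ : ℝ → 𝒟.carrier} {dom : Set ℝ}
    (hγ : 𝒟.metric.IsNormalisedNullRayFrom 𝒟.timeOrientation 𝒟.embed 𝒟.normal p γ dom)
    (hdom : ¬ BddAbove dom) {t : ℝ} (ht : t ∈ dom) (ht0 : 0 ≤ t)
    (hwB : γ t ∈ interior B) (hTw : ContinuousAt T (γ t)) (hSw : S < T (γ t)) :
    γ t ∈ closure (⋃ i, d.chart i '' {x | τ₁ < (d.background i).time x.1 ∧
      (d.background i).radius x.1 ≤ R i ((d.background i).time x.1)}) :=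
  shadowCovering d R τ₁ hexh ha hb hc hd (hrays p γ dom hγ hdom t ht ht0) hwB hTw hSw

end Summit.FinalStateConjecture.FinalStateConjecture.Theorems.LaminatedThreshold.HorizonShadowedBag
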